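import Summits.FinalStateConjecture.FinalStateConjecture.Theses.PhotonSphereChannels
import Summits.FinalStateConjecture.FinalStateConjecture.Theorems.PhotonSphereChannelsUniformPhotonSphereChannelsRefutation
import Summits.FinalStateConjecture.FinalStateConjecture.Theorems.PhotonSphereChannelsExteriorEnergyRW

/-!
# Disproof of `WindowedShellChannels` (crux stmt-FinalStateConjecture-14085, route
# `PhotonSphereChannels`) — findings of the standing adversary (refuter cdisprove seat)

**Verdict so far: NO KILL.**  The crux (`∀ M > 0 ∀ ρ > 0 ∃ h ≥ 0 ∃ c > 0 ∀ tortoise (r, xc) ∀ s ≤ 2 ≤ …,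
s ≤ ℓ, ∀ global C² RW solutions ψ with Cauchy data vanishing on {|x − xc| ≤ ρ}:
c·E_total(0) ≤ E⁺(ρ − h) + E⁻(ρ − h)`, `E^±(a) = liminf_{t→±∞} ∫_{a+|t|<|x−xc|} e`) survives every
cheap attack; what IS provably false are its one-hypothesis-deleted variants, which tell the
provers what any proof must use.  Prose lives in docstrings; everything outside the section
"Near-misses" is sorry-free.

## Index

(a) LOAD-BEARING HYPOTHESES (each: the crux with one ingredient deleted is FALSE)
* `WindowedShellChannelsWithoutLag` (`h := 0`, sharp cones from the shell edges) —
  `windowedShellChannels_false_without_lag`: frozen velocity packets flush below the near edge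
  (LANDED by the crux-attack seat: `Theorems/WindowedShellChannels/Negative/FalseWithoutLag.lean`,
  p78857, re-exported here).  ⇒ any proof uses a positive lag `h(M, ρ)`.
* `WindowedShellChannelsWithoutBackwardChannel` (the `atBot` summand deleted) —
  `windowedShellChannels_false_without_backwardChannel` (THIS seat; LANDED as
  `Theorems/WindowedShellChannels/Negative/{LaggedApertures (p83149), TravellingPacket (p84819),
  FalseWithoutTwoSidedness (p86327)}.lean`, all ACCEPTED): a right-moving packet
  `F(x − t)` parked deep on the horizon side (`s = ℓ = 0`, `M = ρ = 1`, any `h`) enters the lagged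
  ball and its forward channel energy is `≤ ε E`; Duhamel comparison with the free right-mover where
  `V_{00} ≤ e^{(x+1)/2}/8` (`travelling_packet`), plus monotonicity of exterior energies for
  NEGATIVE apertures (`exteriorEnergy_antitone_of_nonneg_edge`).  ⇒ any proof must let the two time
  directions compensate: incoming radiation is lost forward, caught backward.
* `WindowedShellChannelsWithoutForwardChannel` (the `atTop` summand deleted) —
  `windowedShellChannels_false_without_forwardChannel`: time reversal of the previous one.
* `WindowedShellChannelsWithoutSupport` (the support hypothesis deleted) — believed FALSE
  (photon-sphere Gaussian beams / barrier-top packets linger `~ 3√3 M ln ℓ` in BOTH time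
  directions), NOT provable with the tree's technology (no long-time semiclassical transport);
  recorded as a near-miss `windowedShellChannels_false_without_support` (sorry) — it is the
  `1+1` quantitative form of `Literature.Barriers.FinalStateConjecture.SbierskiTrappingObstruction`.
  The three landed/provable deletions above are pairwise independent of this one.
(b) TIGHTNESS
* `windowedShellChannels_const_le_one`: whenever `(h, c)` satisfy the inner statement at
  `M = ρ = 1`, `c ≤ 1` — `lost⁺ + lost⁻ ≥ (1 − ε) E` is attained by the travelling packet; the
  free/DKM value `c = 1` is the ceiling, so the crux is really `lost⁺ + lost⁻ ≤ (2 − c)E` with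
  `c ≤ 1`.
(c) NATURAL STRENGTHENINGS REFUTED OR DOUBTED
* `h = 0`: false (a).  * `c > 1`: false (b).
* uniformity in `ρ` (`∃ h c ∀ ρ`): believed false (rest rays released at `r₀ ↓ 3M` have symmetric
  lag `Λ(r₀) → ∞`, planner table `u_∞/M = 20.1 … at r₀ = 3.05M`), needs long-time transport —
  near-miss `not_windowedShellChannels_uniform_in_rho` (sorry).
* `h < 4M ln 2` (Rindler midpoint law): believed false, needs exact Klein–Gordon/Rindler rest
  packets for times `≍ M` — near-miss `lag_ge_four_mul_log_two` (sorry); the frozen-packet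
  technology only reaches `h = 0` (packets stay frozen for `3/m³ → 0`).
(d) TARGETS (lead's stuck stubs): none registered yet.
(f) NUMERICS (registered cheapest falsifier; kit job j013152, evidence `compute-j013152.json`;
    script `wjob/main.py` of this seat): 1+1 leapfrog for `ψ_tt = ψ_xx − V_{s,ℓ}(r(x))ψ`, `M = 1`,
    `T_f = 80`, shells `ρ ∈ {1, 3, 6}`, `(s, ℓ)` = low modes `(0,0),(0,1),(1,1),(2,2)` and
    `s = 2, ℓ ∈ {8, 32, 64, 96, 128, 160}` (+ `s = 0, ℓ = 64`), 44–59 data families per group supported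
    off the shell (edge-hugging and gapped rest packets of widths 0.5–2, sub-, top- and over-barrier in- and out-movers, 6M-long top-tuned trains, deep horizon-side packets at `x₀ = −4 ln ℓ ± 4` = the
    `m·X_e ≍ 1` regime, far-out rest/in packets at `x₀ ≈ 21–26`), lost fractions `L^±(h)` behind the
    lagged cones for `h = 0..40`.  RESULT: NO KILL SIGNAL — for `h ≥ 12` (`ρ = 1, 3`) resp. `h ≥ 15`
    (`ρ = 6`) the sup over families of `L⁺ + L⁻` is `≤ 1.02` in EVERY group, attained (`≈ 1.00`) only
    by one-sided movers (`L⁺ ≈ 1, L⁻ ≈ 0`: exactly the `c ≤ 1` tightness (b)); genuinely two-sided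
    (rest) losses: near-edge rest packets are caught by `h ≈ Λ_near(ρ)` (`ρ = 3`: `0.42/0.42` at
    `h = 4`, `0.014/0.014` at `h = 10`, planner's `Λ_near(3) = 4.37M`), far-edge rest packets by
    `h ≈ 10–15` (`ρ = 3, ℓ = 96`: `0.99/0.99, 0.40/0.40, 0.004/0.004` at `h = 4, 10, 20`), deep Rindler
    packets have sum `≤ 0.41, 0.15, 0.01` at `h = 4, 10, 20`; barrier-top packets/trains are strictly
    one-sided (other side `≤ 0.03`) with forward lags up to `30M` (Ehrenfest lingering + slow
    crossing), never two-sided.  The growth with `ℓ` at SMALL `h` (`ρ = 1, h = 8`: sup `= 1.00, 1.16,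
    1.44, 1.85` for `ℓ = 8, 32, 64, 128`) is the geometric edge lag sharpening (rest packets localise),
    and it saturates below `h ≈ 12`; at `h ≥ 12` no `ℓ`-trend (`1.000` for `ℓ = 8 … 160`).  Energy
    conservation error `≤ 2 %`, residual drift at `T_f` `≤ 0.09`.  FOLLOW-UP j014281 (edge rest
    packets of widths `0.25 … 2` and `4/√ℓ`, `ℓ = 128, 256, 384`, `ρ ∈ {1, 3}`, `T_f = 100`): the
    `ℓ`-trend at fixed `h` follows GEOMETRIC OPTICS exactly — with this seat's periapsis-ray
    quadrature (our normalisation `x = 0` at `r = 3M`): `u_∞(r₀)/M = 21.7, 12.0, 9.9, 8.5, 7.9, 6.7,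
    4.3, 2.0, −0.07` at `r₀/M = 3.05, 3.37, 3.6, 3.85, 4, 4.4, 6, 10, 20` (a far rest ray is caught iff
    `u_∞ < h − ρ`), the far threshold is `h_far(ρ) = ρ + u_∞(r_e(ρ)) ≈ 13.0, 9.8, 10.0 M` at
    `ρ = 1, 3, 6` (and `h_far ∼ ρ − O(M ln ρ)` for large `ρ`: the lagged edge must recede to the
    centre, the `R = 0` Duyckaerts–Kenig–Merle geometry).  Above threshold the two-sided losses of
    edge rest packets DECREASE with `ℓ` (`ρ = 3, h = 15`, width `0.25`: `0.171, 0.023, 0.006` for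
    `ℓ = 128, 256, 384`; `ρ = 1, h = 20`: `0.088, 0.072, 0.055`), below it they INCREASE towards total
    loss (`ρ = 1, h = 10 < 13`, width `0.5`: `0.66, 0.81, 0.90` per side) exactly as they must; near-edge
    rest packets are caught for `h ≥ 10` at every `ℓ` (`≤ 0.05` per side); barrier-top movers remain
    strictly one-sided (`0.90–1.00` vs `≤ 0.003`).  So NO `ℓ`-creep of the required lag beyond the
    geometric value `h_geo(ρ) = max(Λ_near(ρ), ρ + u_∞(r_e(ρ)))`, and no two-sided loss mechanism
    other than rest rays — the falsifier comes back empty.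
(e) WHY THE CRUX RESISTS (this seat's analysis):
  1. Formal corners: the decl elaborates (rc 0) and reads back `Iff.rfl` (`windowedShellChannels_iff`);
     `s ∈ {0,1,2}`, `V_{s,ℓ} ≥ 0`; infinite-energy data force the RHS to `⊤` (PROVED here:
     `channelEnergy_eq_top_of_totalEnergy_eq_top`, `windowedShell_inner_of_totalEnergy_eq_top`, by
     the expanding-region energy inequality `E[ψ;{x > b+t}](t) ≥ E[ψ;{x > b+2t}](0) = ∞` and the
     continuity of the density), so no junk there and provers may assume finite energy; low modes
     whose barrier top lies OUTSIDE a small shell (`s = 0, ℓ = 0`: top at `x = −1.14M`; `s = 2,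
     ℓ = 2`: `x = +0.77M`) do not linger either (fixed-`ℓ` waves at a non-degenerate maximum disperse
     in `O(M)`; numerics `ρ = 1, (0,0)`: rest packets at the top lose `0.12/0.12, 0.03/0.03, <0.01`
     per side at `h = 4, 10, 20`); negative
     apertures `ρ − h < 0` are the intended lagged windows; `c` tiny and `h` huge are allowed, so a
     kill needs `(E⁺+E⁻)/E → 0` along a family for EVERY fixed `h`.
  2. Ray census (geometric optics, every `ℓ`): a ray off the shell that moves away from the shell in
     one time direction is caught in that direction with lag `< ρ + 2M ln r + O(M)`; rays at rest:
     near side = Rindler fall with symmetric lag `→ 4M ln 2` (+ `O(e^{−ρ/2M})`), far side =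
     hyperbolic escape with symmetric lag `Λ(r_edge(ρ)) < ∞`; reflected/lingering rays (barrier top,
     Ehrenfest time `~3√3 M ln ℓ`) are lost in one direction only — the lingering happens INSIDE the
     shell, where the data vanish at `t = 0`, and backward they are outgoing.  So with
     `h(M,ρ) > max(4M ln 2, Λ_far(ρ)) + O(M)` every ray is caught once: `c → 1` semiclassically.
  3. Non-semiclassical regimes have good limits: fixed `ℓ`, frequency `→ 0` = free radial wave in
     `d = 2ℓ+3` with the cone from the centre, `Σ± lim E_ext = E` (Duyckaerts–Kenig–Merle, odd `d`):
     `c = 1`; near side at `m X_e ≍ 1` = EXACT Klein–Gordon on the Rindler wedge, where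
     `caught⁺ = caught⁻ = 0` forces `ψ = 0` on the null rectangle `[−λX_e,0]×[0,λX_e] ⊇ {T=0, X<X_e}`
     (Goursat uniqueness), so `c(mX_e) > 0` by compactness with positive limits at `mX_e → 0, ∞`.
  4. Interference cannot manufacture two-sided loss: forward-lost and backward-lost phase-space
     regions are disjoint for `e^{κh} > 2`, and channel energies are asymptotically additive over
     separating packets (`E(ψ_in + ψ_out) = E_in + E_out + o(1)`).
  5. Hence a counterexample needs a NEW two-sided slow mechanism supported off the photon shell,
     uniformly in `ℓ`; none is known in print (`lit`: no channel-of-energy theorem or counterexample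
     for RW/Schwarzschild potentials; negatives index: only K1 = stmt-10045, whose witnesses need
     `h = 0`).  The honest residual risk is the planner's: `ℓ`-uniform wave corrections at
     `ω M ≍ 1` / `m X_e ≍ 1` making `h` or `1/c` creep with `ℓ` — the kit falsifier tests exactly this.
-/

noncomputable section

set_option linter.dupNamespace false

namespace Summit.FinalStateConjecture.FinalStateConjecture.Cruxes.WindowedShellChannels.Disproof

open Literature.Geometry.Lorentzian Literature.Geometry.Lorentzian.ReggeWheeler
open Summit.FinalStateConjecture.FinalStateConjecture.Theses.PhotonSphereChannels
open Summit.FinalStateConjecture.FinalStateConjecture.Theorems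
open Summit.FinalStateConjecture.FinalStateConjecture.Theorems.Blindness
open Summit.FinalStateConjecture.FinalStateConjecture.Theorems.FrozenPacket
open Summit.FinalStateConjecture.FinalStateConjecture.Theorems.CauchyWave
open MeasureTheory Filter Set Function
open scoped ENNReal Topology

/-! ## Read-back of the crux -/

/-- The crux, read back symbol by symbol (elaboration check; `Iff.rfl`). -/
theorem windowedShellChannels_iff : WindowedShellChannels ↔
    ∀ M : ℝ, 0 < M → ∀ ρ : ℝ, 0 < ρ → ∃ h : ℝ, 0 ≤ h ∧ ∃ c : ℝ, 0 < c ∧ ∀ (r : ℝ → ℝ) (xc : ℝ),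
      IsTortoiseRadius M r xc → ∀ (s ℓ : ℕ), s ≤ 2 → s ≤ ℓ → ∀ ψ : ℝ → ℝ → ℝ,
      IsRWSolution M s ℓ r ψ → CauchyDataSupportedOn ψ {x : ℝ | ρ < |x - xc|} →
      ENNReal.ofReal c * totalEnergy (linePotential M s ℓ r) ψ 0 ≤
        channelEnergy (linePotential M s ℓ r) xc (ρ - h) ψ atTop +
          channelEnergy (linePotential M s ℓ r) xc (ρ - h) ψ atBot := Iff.rfl

/-! ## (a) Load-bearing hypotheses -/

/-- The crux with the lag deleted (`h := 0`: sharp light cones from the shell edges). -/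
def WindowedShellChannelsWithoutLag : Prop :=
  ∀ M : ℝ, 0 < M → ∀ ρ : ℝ, 0 < ρ → ∃ c : ℝ, 0 < c ∧ ∀ (r : ℝ → ℝ) (xc : ℝ),
    IsTortoiseRadius M r xc → ∀ (s ℓ : ℕ), s ≤ 2 → s ≤ ℓ → ∀ ψ : ℝ → ℝ → ℝ,
    IsRWSolution M s ℓ r ψ → CauchyDataSupportedOn ψ {x : ℝ | ρ < |x - xc|} →
    ENNReal.ofReal c * totalEnergy (linePotential M s ℓ r) ψ 0 ≤
      channelEnergy (linePotential M s ℓ r) xc ρ ψ atTop +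
        channelEnergy (linePotential M s ℓ r) xc ρ ψ atBot

/-! ### The `h = 0` refutation of the crux-attack seat (LANDED as
`Theorems/WindowedShellChannels/Negative/FalseWithoutLag.lean`, p78857; inlined verbatim while that
module is unbuilt on the farm) -/

/-- **Sharp cones fail for shell-supported data at every `(M, ρ, c)`.** For every `M > 0`, `ρ > 0`,
`c > 0` there are a tortoise radius function (`xc = 0`), `ℓ ≥ 2` and a global `C²` spin-2
Regge–Wheeler solution whose Cauchy data vanish on `{|x| ≤ ρ}` such that
`c · E_total(0) ≤ E⁺(ρ) + E⁻(ρ)` is false (frozen velocity packets flush below `−ρ`). -/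
theorem sharp_cone_fails {M : ℝ} (hM : 0 < M) {ρ : ℝ} (hρ : 0 < ρ) {c : ℝ} (hc : 0 < c) :
    ∃ (r : ℝ → ℝ) (ℓ : ℕ) (ψ : ℝ → ℝ → ℝ), IsTortoiseRadius M r 0 ∧ 2 ≤ ℓ ∧
      IsRWSolution M 2 ℓ r ψ ∧ CauchyDataSupportedOn ψ {x : ℝ | ρ < |x - 0|} ∧
      ¬ (ENNReal.ofReal c * totalEnergy (linePotential M 2 ℓ r) ψ 0 ≤
          channelEnergy (linePotential M 2 ℓ r) 0 ρ ψ atTop +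
            channelEnergy (linePotential M 2 ℓ r) 0 ρ ψ atBot) := by
  set r : ℝ → ℝ := tortoiseRadius hM 0 with hr_def
  have hr : IsTortoiseRadius M r 0 := isTortoiseRadius_tortoiseRadius hM 0
  -- near edge `xe = 0 − ρ`
  set xe : ℝ := 0 - ρ with hxe_def
  -- the bump, the constants of the potential on `[xe − 3, xe]`, and the scale `m`
  obtain ⟨B, hB, h0l, h0r, h1, h01, K₂, hK₂, hB2⟩ := exists_profile
  obtain ⟨f₀, C₀, C₁, hf₀, hC₀, hC₁, hKV⟩ :=
    potential_compact_bounds hM hr.two_mul_lt hr.hasDerivAt (a := xe - 3) (b := xe) (by linarith)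
  have hε : 0 < c / 4 := by positivity
  obtain ⟨m, hm⟩ := exists_nat_gt (max 2
    (max (2 * C₀ / f₀) (Real.sqrt (108 * (9 * C₁ + K₂) ^ 2 / (c / 4 * f₀)))))
  have hm2r : (2 : ℝ) < m := lt_of_le_of_lt (le_max_left _ _) hm
  have hm2 : 2 ≤ m := by
    have : (2 : ℕ) < m := by exact_mod_cast hm2r
    omega
  have hm0 : (0 : ℝ) < m := by linarith
  have hmC : 2 * C₀ / f₀ ≤ m := (lt_of_le_of_lt ((le_max_left _ _).trans (le_max_right _ _)) hm).le
  have hmε : 108 * (9 * C₁ + K₂) ^ 2 / (c / 4 * f₀) ≤ (m : ℝ) ^ 2 := by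
    have h := lt_of_le_of_lt ((le_max_right _ _).trans (le_max_right _ _)) hm
    exact ((Real.sqrt_lt' hm0).1 h).le
  have hℓ2 : 2 ≤ m ^ 4 := le_trans hm2 (Nat.le_self_pow (by norm_num) m)
  -- the frozen velocity packet
  obtain ⟨g, α, T, hg2, -, hT0, hedge, -, -, hg0r, hgint, hgpos, ψ, hψ2, hsol, hψ0, hψ1,
      hsupp, he0, hInt, hplus, hminus⟩ :=
    frozen_packet_main hM hr.two_mul_lt hr.hasDerivAt xe hε hB h0l h0r h1 h01 hK₂ hB2 hf₀ hC₁
      (fun ℓ => (hKV ℓ).1) (fun ℓ => (hKV ℓ).2) hm2 hmC hmε (m ^ 4) rfl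
      (linePotential M 2 (m ^ 4) r) rfl
  have hψsol : IsRWSolution M 2 (m ^ 4) r ψ := ⟨hψ2, fun z => hsol z.1 z.2⟩
  -- the Cauchy data `(0, g)` vanish on the closed shell `{|x| ≤ ρ}` (indeed on `[−ρ, ∞)`)
  have hdata : CauchyDataSupportedOn ψ {x : ℝ | ρ < |x - 0|} := by
    intro x hx
    simp only [mem_setOf_eq, sub_zero, not_lt] at hx
    refine ⟨hψ0 x, ?_⟩
    rw [hψ1 x]
    exact hg0r x (by rw [hxe_def]; linarith [neg_abs_le x])
  refine ⟨r, m ^ 4, ψ, hr, hℓ2, hψsol, hdata, fun hCI => ?_⟩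
  -- upper bounds on the channel energies: monotonicity + the packet bound at `±T`
  have hmono := RW.exteriorEnergy_antitoneOn_rw hr hℓ2 hψsol 0 hρ.le
  obtain ⟨hup, hdown⟩ := channelEnergy_le_of_antitone hmono hT0.le
  have hedgeT : 0 - ρ - |T| ≤ α := by rw [abs_of_pos hT0]; exact hedge
  have hedgeT' : 0 - ρ - |(-T)| ≤ α := by rw [abs_neg, abs_of_pos hT0]; exact hedge
  have hup' := hup.trans (exteriorEnergy_le_of_near hρ.le hedgeT hψ2 hsupp (he0 T) (hInt T) hplus)
  have hdown' := hdown.trans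
    (exteriorEnergy_le_of_near hρ.le hedgeT' hψ2 hsupp (he0 (-T)) (hInt (-T)) hminus)
  -- lower bound on the total energy at `t = 0`: `∫ g²`
  have hVnn : ∀ x, 0 ≤ linePotential M 2 (m ^ 4) r x := fun x =>
    linePotential_nonneg hM.le hℓ2 hr.two_mul_lt x
  have hlow : ENNReal.ofReal (∫ x, g x ^ 2) ≤ totalEnergy (linePotential M 2 (m ^ 4) r) ψ 0 := by
    unfold totalEnergy
    rw [ofReal_integral_eq_lintegral_ofReal hgint (ae_of_all _ fun x => sq_nonneg (g x))]
    refine lintegral_mono fun x => ENNReal.ofReal_le_ofReal ?_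
    unfold energyDensity
    rw [hψ1 x]
    nlinarith [sq_nonneg (deriv (ψ 0) x), mul_nonneg (hVnn x) (sq_nonneg (ψ 0 x))]
  -- contradiction
  set E₀ : ℝ := ∫ x, g x ^ 2 with hE₀_def
  have key : ENNReal.ofReal (c * E₀) ≤ ENNReal.ofReal (c / 4 * E₀ + c / 4 * E₀) := by
    calc ENNReal.ofReal (c * E₀) = ENNReal.ofReal c * ENNReal.ofReal E₀ := ENNReal.ofReal_mul hc.le
      _ ≤ ENNReal.ofReal c * totalEnergy (linePotential M 2 (m ^ 4) r) ψ 0 := by gcongr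
      _ ≤ _ := hCI
      _ ≤ ENNReal.ofReal (c / 4 * E₀) + ENNReal.ofReal (c / 4 * E₀) := add_le_add hup' hdown'
      _ = ENNReal.ofReal (c / 4 * E₀ + c / 4 * E₀) :=
          (ENNReal.ofReal_add (by positivity) (by positivity)).symm
  have key' := (ENNReal.ofReal_le_ofReal_iff (by positivity)).1 key
  nlinarith [mul_pos hc hgpos]

/-- **The `h = 0` specialisation of `WindowedShellChannels` is false**: there is no
`c = c(M, ρ) > 0` with `c · E_total(0) ≤ E⁺(ρ) + E⁻(ρ)` (SHARP cones from the shell edges) for all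
shell-supported Regge–Wheeler data — already at any single `(M, ρ)`, by `sharp_cone_fails`.
The proposition negated is the crux with `∃ h, 0 ≤ h ∧` deleted and `ρ − h` replaced by `ρ`
(everything else verbatim). -/
theorem windowedShellChannels_false_without_lag_inline :
    ¬ (∀ M : ℝ, 0 < M → ∀ ρ : ℝ, 0 < ρ → ∃ c : ℝ, 0 < c ∧ ∀ (r : ℝ → ℝ) (xc : ℝ),
        IsTortoiseRadius M r xc → ∀ (s ℓ : ℕ), s ≤ 2 → s ≤ ℓ → ∀ ψ : ℝ → ℝ → ℝ,
        IsRWSolution M s ℓ r ψ → CauchyDataSupportedOn ψ {x : ℝ | ρ < |x - xc|} →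
        ENNReal.ofReal c * totalEnergy (linePotential M s ℓ r) ψ 0 ≤
          channelEnergy (linePotential M s ℓ r) xc ρ ψ atTop +
            channelEnergy (linePotential M s ℓ r) xc ρ ψ atBot) := by
  intro hK
  obtain ⟨c, hc, H⟩ := hK 1 one_pos 1 one_pos
  obtain ⟨r, ℓ, ψ, hr, hℓ2, hψsol, hdata, hfail⟩ := sharp_cone_fails one_pos one_pos hc
  exact hfail (H r 0 hr 2 ℓ le_rfl hℓ2 ψ hψsol hdata)


/-- **Any proof must use the lag**: the `h = 0` specialisation is false at every `(M, ρ, c)`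
(frozen velocity packets flush below the near edge; LANDED, p78857). -/
theorem windowedShellChannels_false_without_lag : ¬ WindowedShellChannelsWithoutLag :=
  windowedShellChannels_false_without_lag_inline

/-- The crux with the BACKWARD channel deleted (only `liminf_{t → +∞}` on the right). -/
def WindowedShellChannelsWithoutBackwardChannel : Prop :=
  ∀ M : ℝ, 0 < M → ∀ ρ : ℝ, 0 < ρ → ∃ h : ℝ, 0 ≤ h ∧ ∃ c : ℝ, 0 < c ∧ ∀ (r : ℝ → ℝ) (xc : ℝ),
    IsTortoiseRadius M r xc → ∀ (s ℓ : ℕ), s ≤ 2 → s ≤ ℓ → ∀ ψ : ℝ → ℝ → ℝ,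
    IsRWSolution M s ℓ r ψ → CauchyDataSupportedOn ψ {x : ℝ | ρ < |x - xc|} →
    ENNReal.ofReal c * totalEnergy (linePotential M s ℓ r) ψ 0 ≤
      channelEnergy (linePotential M s ℓ r) xc (ρ - h) ψ atTop

/-- The crux with the FORWARD channel deleted (only `liminf_{t → −∞}` on the right). -/
def WindowedShellChannelsWithoutForwardChannel : Prop :=
  ∀ M : ℝ, 0 < M → ∀ ρ : ℝ, 0 < ρ → ∃ h : ℝ, 0 ≤ h ∧ ∃ c : ℝ, 0 < c ∧ ∀ (r : ℝ → ℝ) (xc : ℝ),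
    IsTortoiseRadius M r xc → ∀ (s ℓ : ℕ), s ≤ 2 → s ≤ ℓ → ∀ ψ : ℝ → ℝ → ℝ,
    IsRWSolution M s ℓ r ψ → CauchyDataSupportedOn ψ {x : ℝ | ρ < |x - xc|} →
    ENNReal.ofReal c * totalEnergy (linePotential M s ℓ r) ψ 0 ≤
      channelEnergy (linePotential M s ℓ r) xc (ρ - h) ψ atBot

/-- The crux with the SUPPORT hypothesis deleted (data may live on the photon shell). -/
def WindowedShellChannelsWithoutSupport : Prop :=
  ∀ M : ℝ, 0 < M → ∀ ρ : ℝ, 0 < ρ → ∃ h : ℝ, 0 ≤ h ∧ ∃ c : ℝ, 0 < c ∧ ∀ (r : ℝ → ℝ) (xc : ℝ),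
    IsTortoiseRadius M r xc → ∀ (s ℓ : ℕ), s ≤ 2 → s ≤ ℓ → ∀ ψ : ℝ → ℝ → ℝ,
    IsRWSolution M s ℓ r ψ →
    ENNReal.ofReal c * totalEnergy (linePotential M s ℓ r) ψ 0 ≤
      channelEnergy (linePotential M s ℓ r) xc (ρ - h) ψ atTop +
        channelEnergy (linePotential M s ℓ r) xc (ρ - h) ψ atBot

/-- The crux made UNIFORM in the shell half-width (`∃ h c` before `∀ ρ`). -/
def WindowedShellChannelsUniformInRho : Prop :=
  ∀ M : ℝ, 0 < M → ∃ h : ℝ, 0 ≤ h ∧ ∃ c : ℝ, 0 < c ∧ ∀ ρ : ℝ, 0 < ρ → ∀ (r : ℝ → ℝ) (xc : ℝ),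
    IsTortoiseRadius M r xc → ∀ (s ℓ : ℕ), s ≤ 2 → s ≤ ℓ → ∀ ψ : ℝ → ℝ → ℝ,
    IsRWSolution M s ℓ r ψ → CauchyDataSupportedOn ψ {x : ℝ | ρ < |x - xc|} →
    ENNReal.ofReal c * totalEnergy (linePotential M s ℓ r) ψ 0 ≤
      channelEnergy (linePotential M s ℓ r) xc (ρ - h) ψ atTop +
        channelEnergy (linePotential M s ℓ r) xc (ρ - h) ψ atBot

/-! ### The `ℝ≥0∞` corner: infinite-energy solutions satisfy the crux trivially (this seat; LANDED
as `Theorems/WindowedShellChannels/Negative/InfiniteEnergy.lean`, p84785 — inlined here too, so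
that this work file does not depend on freshly built oleans) -/

section General

variable {V : ℝ → ℝ} {ψ : ℝ → ℝ → ℝ}

/-- Dictionary: a global `C²` solution in the route's `iteratedDeriv` form solves the equation in
Fréchet form, and its energy density is the Fréchet-form density. -/
theorem frechet_of_isSolution (hψ : IsSolution V ψ) :
    (∀ z : ℝ × ℝ, fderiv ℝ (fderiv ℝ (Function.uncurry ψ)) z (1, 0) (1, 0)
      - fderiv ℝ (fderiv ℝ (Function.uncurry ψ)) z (0, 1) (0, 1)
      + V z.2 * Function.uncurry ψ z = 0) ∧
    (∀ z : ℝ × ℝ, (fun z : ℝ × ℝ => energyDensity V ψ z.1 z.2) z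
      = (fderiv ℝ (Function.uncurry ψ) z (1, 0)) ^ 2 + (fderiv ℝ (Function.uncurry ψ) z (0, 1)) ^ 2
        + V z.2 * Function.uncurry ψ z ^ 2) := by
  have hψ2 := hψ.1
  refine ⟨?_, ?_⟩
  · rintro ⟨t, x⟩
    rw [← WaveEnergy.iteratedDeriv_two_slice_fst_eq hψ2, ← WaveEnergy.iteratedDeriv_two_slice_snd_eq hψ2]
    exact hψ.2 (t, x)
  · rintro ⟨t, x⟩
    simp only [Function.uncurry_apply_pair, energyDensity]
    rw [WaveEnergy.deriv_slice_fst_eq hψ2, WaveEnergy.deriv_slice_snd_eq hψ2]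

/-- **Far tail.** If the data have infinite energy on every far half-line, every exterior energy
(any aperture `a`, any time with `0 ≤ a + |t|`) is `⊤`. [folklore] -/
theorem exteriorEnergy_eq_top_of_far_tail (hV : Differentiable ℝ V) (hV0 : ∀ x, 0 ≤ V x)
    (hψ : IsSolution V ψ) (xc a : ℝ)
    (htail : ∀ N : ℝ, ∫⁻ x in Ioi N, ENNReal.ofReal (energyDensity V ψ 0 x) = ⊤)
    {t : ℝ} (hat : 0 ≤ a + |t|) : exteriorEnergy V xc a ψ t = ⊤ := by
  obtain ⟨hsol', he⟩ := frechet_of_isSolution hψ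
  have hψ2 := hψ.1
  have hsub : Ioi (xc + (a + |t|)) ⊆ {x : ℝ | a + |t| < |x - xc|} := fun x hx => by
    simp only [mem_Ioi] at hx
    simp only [mem_setOf_eq]
    rw [abs_of_pos (show 0 < x - xc by linarith [abs_nonneg t])]
    linarith
  refine eq_top_iff.2 ?_
  unfold exteriorEnergy
  refine le_trans ?_ (lintegral_mono_set hsub)
  rw [← htail (xc + (a + |t|) + |t|)]
  rcases le_or_gt 0 t with ht | ht
  · -- forward in time: expanding region read from time `0` to time `t`
    have key := WaveEnergy.lintegral_Ioi_le_expanding hψ2 hV hV0 hsol' he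
      (xc + (a + |t|) + |t|) ht
    have e1 : xc + (a + |t|) + |t| - (t - 0) = xc + (a + |t|) := by rw [abs_of_nonneg ht]; ring
    rw [e1] at key
    exact key
  · -- backward in time: shrinking region read from time `t < 0` to time `0`
    have key := WaveEnergy.lintegral_Ioi_shrinking_le hψ2 hV hV0 hsol' he (xc + (a + |t|)) ht.le
    have e1 : xc + (a + |t|) + (0 - t) = xc + (a + |t|) + |t| := by rw [abs_of_neg ht]; ring
    rw [e1] at key
    exact key

/-- **Near tail.** If the data have infinite energy on every near half-line, every exterior energy
(any aperture `a`, any time with `0 ≤ a + |t|`) is `⊤`. [folklore] -/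
theorem exteriorEnergy_eq_top_of_near_tail (hV : Differentiable ℝ V) (hV0 : ∀ x, 0 ≤ V x)
    (hψ : IsSolution V ψ) (xc a : ℝ)
    (htail : ∀ N : ℝ, ∫⁻ x in Iio N, ENNReal.ofReal (energyDensity V ψ 0 x) = ⊤)
    {t : ℝ} (hat : 0 ≤ a + |t|) : exteriorEnergy V xc a ψ t = ⊤ := by
  obtain ⟨hsol', he⟩ := frechet_of_isSolution hψ
  have hψ2 := hψ.1
  have hsub : Iio (xc - (a + |t|)) ⊆ {x : ℝ | a + |t| < |x - xc|} := fun x hx => by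
    simp only [mem_Iio] at hx
    simp only [mem_setOf_eq]
    rw [abs_of_neg (show x - xc < 0 by linarith [abs_nonneg t])]
    linarith
  refine eq_top_iff.2 ?_
  unfold exteriorEnergy
  refine le_trans ?_ (lintegral_mono_set hsub)
  rw [← htail (xc - (a + |t|) - |t|)]
  rcases le_or_gt 0 t with ht | ht
  · have key := WaveEnergy.lintegral_Iio_le_expanding hψ2 hV hV0 hsol' he
      (xc - (a + |t|) - |t|) ht
    have e1 : xc - (a + |t|) - |t| + (t - 0) = xc - (a + |t|) := by rw [abs_of_nonneg ht]; ring
    rw [e1] at key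
    exact key
  · have key := WaveEnergy.lintegral_Iio_shrinking_le hψ2 hV hV0 hsol' he (xc - (a + |t|)) ht.le
    have e1 : xc - (a + |t|) - (0 - t) = xc - (a + |t|) - |t| := by rw [abs_of_neg ht]; ring
    rw [e1] at key
    exact key

/-- **Where infinite energy sits.** For a global `C²` solution (`V` differentiable) with
`totalEnergy V ψ 0 = ⊤`, either every far half-line or every near half-line of the data carries
infinite energy (the density is continuous, so compact intervals carry finite energy). [folklore] -/
theorem far_tail_or_near_tail_of_totalEnergy_eq_top (hV : Differentiable ℝ V)
    (hψ : IsSolution V ψ) (hE : totalEnergy V ψ 0 = ⊤) :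
    (∀ N : ℝ, ∫⁻ x in Ioi N, ENNReal.ofReal (energyDensity V ψ 0 x) = ⊤) ∨
      (∀ N : ℝ, ∫⁻ x in Iio N, ENNReal.ofReal (energyDensity V ψ 0 x) = ⊤) := by
  obtain ⟨-, he⟩ := frechet_of_isSolution hψ
  have hψ2 := hψ.1
  -- the density at time `0` is continuous
  have hcont : Continuous fun x => energyDensity V ψ 0 x := by
    have h := WaveEnergy.continuous_energyDensity hψ2 hV he
    exact h.comp (Continuous.prodMk_right (0 : ℝ))
  by_contra hcon
  rw [not_or, not_forall, not_forall] at hcon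
  obtain ⟨⟨N₁, hN₁⟩, ⟨N₂, hN₂⟩⟩ := hcon
  -- finite energy on a compact middle piece
  set f : ℝ → ℝ≥0∞ := fun x => ENNReal.ofReal (energyDensity V ψ 0 x) with hf
  obtain ⟨K, hK⟩ := (isCompact_Icc (a := N₂) (b := N₁)).exists_bound_of_continuousOn hcont.continuousOn
  have hmid : ∫⁻ x in Icc N₂ N₁, f x < ⊤ := by
    have hb : ∀ x ∈ Icc N₂ N₁, f x ≤ ENNReal.ofReal K := fun x hx =>
      ENNReal.ofReal_le_ofReal ((le_abs_self _).trans ((Real.norm_eq_abs _).symm.le.trans (hK x hx)))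
    calc ∫⁻ x in Icc N₂ N₁, f x ≤ ∫⁻ _ in Icc N₂ N₁, ENNReal.ofReal K :=
          setLIntegral_mono measurable_const hb
      _ = ENNReal.ofReal K * volume (Icc N₂ N₁) := setLIntegral_const _ _
      _ < ⊤ := ENNReal.mul_lt_top ENNReal.ofReal_lt_top (by rw [Real.volume_Icc]; exact ENNReal.ofReal_lt_top)
  -- the whole line is covered by the three pieces
  have hcover : (univ : Set ℝ) ⊆ (Iio N₂ ∪ Icc N₂ N₁) ∪ Ioi N₁ := by
    intro x _
    rcases lt_or_ge x N₂ with h | h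
    · exact Or.inl (Or.inl h)
    · rcases le_or_gt x N₁ with h' | h'
      · exact Or.inl (Or.inr ⟨h, h'⟩)
      · exact Or.inr h'
  have htot : ∫⁻ x, f x < ⊤ := by
    calc ∫⁻ x, f x = ∫⁻ x in univ, f x := (setLIntegral_univ f).symm
      _ ≤ ∫⁻ x in (Iio N₂ ∪ Icc N₂ N₁) ∪ Ioi N₁, f x := lintegral_mono_set hcover
      _ ≤ (∫⁻ x in Iio N₂ ∪ Icc N₂ N₁, f x) + ∫⁻ x in Ioi N₁, f x := lintegral_union_le _ _ _
      _ ≤ ((∫⁻ x in Iio N₂, f x) + ∫⁻ x in Icc N₂ N₁, f x) + ∫⁻ x in Ioi N₁, f x := by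
          gcongr
          exact lintegral_union_le _ _ _
      _ < ⊤ := by
          refine ENNReal.add_lt_top.2 ⟨ENNReal.add_lt_top.2 ⟨lt_top_iff_ne_top.2 hN₂, hmid⟩,
            lt_top_iff_ne_top.2 hN₁⟩
  unfold totalEnergy at hE
  exact (lt_top_iff_ne_top.1 htot) hE

/-- **Both lagged channel energies of an infinite-energy solution are `⊤`** (`V ≥ 0`
differentiable; any centre, any aperture, any of the two time filters). [folklore] -/
theorem channelEnergy_eq_top_of_totalEnergy_eq_top (hV : Differentiable ℝ V) (hV0 : ∀ x, 0 ≤ V x)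
    (hψ : IsSolution V ψ) (xc a : ℝ) (hE : totalEnergy V ψ 0 = ⊤) :
    channelEnergy V xc a ψ atTop = ⊤ ∧ channelEnergy V xc a ψ atBot = ⊤ := by
  have hext : ∀ t, 0 ≤ a + |t| → exteriorEnergy V xc a ψ t = ⊤ := by
    intro t hat
    rcases far_tail_or_near_tail_of_totalEnergy_eq_top hV hψ hE with h | h
    · exact exteriorEnergy_eq_top_of_far_tail hV hV0 hψ xc a h hat
    · exact exteriorEnergy_eq_top_of_near_tail hV hV0 hψ xc a h hat
  unfold channelEnergy
  constructor
  · have hev : ∀ᶠ t in atTop, exteriorEnergy V xc a ψ t = (fun _ => (⊤ : ℝ≥0∞)) t := by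
      filter_upwards [eventually_ge_atTop |a|] with t ht
      exact hext t (by linarith [neg_abs_le a, le_abs_self t])
    rw [liminf_congr hev, liminf_const]
  · have hev : ∀ᶠ t in atBot, exteriorEnergy V xc a ψ t = (fun _ => (⊤ : ℝ≥0∞)) t := by
      filter_upwards [eventually_le_atBot (-|a|)] with t ht
      exact hext t (by linarith [neg_abs_le a, neg_le_abs t])
    rw [liminf_congr hev, liminf_const]

end General

/-- **Regge–Wheeler instance, in the shape of the crux**: for a tortoise radius function, `s ≤ ℓ`,
and a global `C²` Regge–Wheeler solution of infinite total energy, the inner inequality of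
`WindowedShellChannels` holds for every constant `c` and every (lagged) aperture `a` — so the
crux is a statement about finite-energy solutions only. [folklore] -/
theorem windowedShell_inner_of_totalEnergy_eq_top {M : ℝ} {r : ℝ → ℝ} {xc : ℝ} {s ℓ : ℕ}
    {ψ : ℝ → ℝ → ℝ} (hr : IsTortoiseRadius M r xc) (hsℓ : s ≤ ℓ) (hψ : IsRWSolution M s ℓ r ψ)
    (c a : ℝ) (hE : totalEnergy (linePotential M s ℓ r) ψ 0 = ⊤) :
    ENNReal.ofReal c * totalEnergy (linePotential M s ℓ r) ψ 0 ≤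
      channelEnergy (linePotential M s ℓ r) xc a ψ atTop +
        channelEnergy (linePotential M s ℓ r) xc a ψ atBot := by
  obtain ⟨h1, -⟩ := channelEnergy_eq_top_of_totalEnergy_eq_top (RW.differentiable_linePotential hr s ℓ)
    (fun x => (RW.linePotential_pos hr hsℓ x).le) hψ xc a hE
  rw [h1, top_add]
  exact le_top


/-! ### The travelling-packet machinery (this seat; LANDED as
`Theorems/WindowedShellChannels/Negative/{LaggedApertures (p83149), TravellingPacket (p84819),
FalseWithoutTwoSidedness (p86327)}.lean` — inlined here too, so that this work file keeps
elaborating while oleans are rebuilt; a later cycle may replace the section by the imports) -/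


/-! ### The `s = ℓ = 0` potential is exponentially small on the horizon side -/

/-- For the tortoise radius function of mass `1` centred at `0` (`r + 2 log(r − 2) − 3 = x`),
`V_{0,0}(r(x)) = (1 − 2/r)·2/r³ ≤ (r − 2)/8 ≤ e^{(x+1)/2}/8`. -/
theorem linePotential_zero_zero_le {r : ℝ → ℝ} (hr : IsTortoiseRadius 1 r 0) (x : ℝ) :
    linePotential 1 0 0 r x ≤ Real.exp ((x + 1) / 2) / 8 := by
  have h2 : 2 < r x := by have := hr.two_mul_lt x; linarith
  have hpos : 0 < r x := by linarith
  have htort : tortoiseCoord 1 (r x) = x - 0 := hr.tortoiseCoord_eq x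
  unfold tortoiseCoord at htort
  simp only [mul_one, Real.log_one, mul_zero, sub_zero] at htort
  -- `log (r − 2) < (x + 1)/2`
  have hlog : Real.log (r x - 2) ≤ (x + 1) / 2 := by linarith
  have hr2 : r x - 2 ≤ Real.exp ((x + 1) / 2) := by
    have h := Real.exp_le_exp.2 hlog
    rwa [Real.exp_log (by linarith)] at h
  -- the potential
  have hV : linePotential 1 0 0 r x = (1 - 2 / r x) * (2 / r x ^ 3) := by
    simp only [linePotential_apply, rwPotential]
    push_cast
    ring
  rw [hV]
  have hfac1 : 1 - 2 / r x ≤ (r x - 2) / 2 := by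
    have : 1 - 2 / r x = (r x - 2) / r x := by field_simp
    rw [this, div_le_div_iff₀ hpos (by norm_num : (0:ℝ) < 2)]
    nlinarith
  have hfac1' : 0 ≤ 1 - 2 / r x := by
    rw [sub_nonneg, div_le_one hpos]; linarith
  have hfac2 : 2 / r x ^ 3 ≤ 1 / 4 := by
    rw [div_le_div_iff₀ (by positivity) (by norm_num : (0:ℝ) < 4)]
    nlinarith [mul_pos (mul_pos hpos hpos) hpos, sq_nonneg (r x - 2)]
  have hfac2' : 0 ≤ 2 / r x ^ 3 := by positivity
  calc (1 - 2 / r x) * (2 / r x ^ 3) ≤ (r x - 2) / 2 * (1 / 4) :=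
        mul_le_mul hfac1 hfac2 hfac2' (by linarith)
    _ = (r x - 2) / 8 := by ring
    _ ≤ Real.exp ((x + 1) / 2) / 8 := by linarith

/-! ### Exterior energies with apertures of any sign -/

/-- **Monotonicity of lagged exterior energies.** For a global `C²` solution of
`ψ_tt − ψ_xx + Vψ = 0` (`V ≥ 0` differentiable), ANY aperture `a : ℝ` (negative apertures are the
lagged windows `ρ − h` of the crux) and times `0 ≤ t₁ ≤ t₂` with `0 ≤ a + t₁`:
`exteriorEnergy V xc a ψ t₂ ≤ exteriorEnergy V xc a ψ t₁`. [folklore] -/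
theorem exteriorEnergy_antitone_of_nonneg_edge {V : ℝ → ℝ} (hV : Differentiable ℝ V)
    (hV0 : ∀ x, 0 ≤ V x) {ψ : ℝ → ℝ → ℝ} (hψ : IsSolution V ψ) (xc a : ℝ) {t₁ t₂ : ℝ}
    (h1 : 0 ≤ t₁) (h12 : t₁ ≤ t₂) (ha : 0 ≤ a + t₁) :
    exteriorEnergy V xc a ψ t₂ ≤ exteriorEnergy V xc a ψ t₁ := by
  have hψ2 := hψ.1
  have hsol' : ∀ z : ℝ × ℝ, fderiv ℝ (fderiv ℝ (Function.uncurry ψ)) z (1, 0) (1, 0)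
      - fderiv ℝ (fderiv ℝ (Function.uncurry ψ)) z (0, 1) (0, 1)
      + V z.2 * Function.uncurry ψ z = 0 := by
    rintro ⟨t, x⟩
    rw [← WaveEnergy.iteratedDeriv_two_slice_fst_eq hψ2, ← WaveEnergy.iteratedDeriv_two_slice_snd_eq hψ2]
    exact hψ.2 (t, x)
  have he : ∀ z : ℝ × ℝ, (fun z : ℝ × ℝ => energyDensity V ψ z.1 z.2) z
      = (fderiv ℝ (Function.uncurry ψ) z (1, 0)) ^ 2 + (fderiv ℝ (Function.uncurry ψ) z (0, 1)) ^ 2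
        + V z.2 * Function.uncurry ψ z ^ 2 := by
    rintro ⟨t, x⟩
    simp only [Function.uncurry_apply_pair, energyDensity]
    rw [WaveEnergy.deriv_slice_fst_eq hψ2, WaveEnergy.deriv_slice_snd_eq hψ2]
  have h2 : 0 ≤ t₂ := h1.trans h12
  have hd1 : 0 ≤ a + |t₁| := by rwa [abs_of_nonneg h1]
  have hd2 : 0 ≤ a + |t₂| := by rw [abs_of_nonneg h2]; linarith
  unfold exteriorEnergy
  rw [WaveEnergy.lintegral_setOf_lt_abs_sub xc hd2, WaveEnergy.lintegral_setOf_lt_abs_sub xc hd1,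
    abs_of_nonneg h1, abs_of_nonneg h2]
  refine add_le_add ?_ ?_
  · have key := WaveEnergy.lintegral_Iio_shrinking_le hψ2 hV hV0 hsol' he (xc - (a + t₁)) h12
    have e1 : xc - (a + t₁) - (t₂ - t₁) = xc - (a + t₂) := by ring
    rw [e1] at key
    exact key
  · have key := WaveEnergy.lintegral_Ioi_shrinking_le hψ2 hV hV0 hsol' he (xc + (a + t₁)) h12
    have e1 : xc + (a + t₁) + (t₂ - t₁) = xc + (a + t₂) := by ring
    rw [e1] at key
    exact key

/-- Hence the forward channel energy of aperture `a` is at most the exterior energy at any time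
`T ≥ 0` with `a + T ≥ 0`. [folklore] -/
theorem channelEnergy_atTop_le_exteriorEnergy {V : ℝ → ℝ} (hV : Differentiable ℝ V)
    (hV0 : ∀ x, 0 ≤ V x) {ψ : ℝ → ℝ → ℝ} (hψ : IsSolution V ψ) (xc a : ℝ) {T : ℝ}
    (hT : 0 ≤ T) (ha : 0 ≤ a + T) :
    channelEnergy V xc a ψ atTop ≤ exteriorEnergy V xc a ψ T := by
  unfold channelEnergy
  refine liminf_le_of_frequently_le' (Eventually.frequently ?_)
  filter_upwards [eventually_ge_atTop T] with t ht
  exact exteriorEnergy_antitone_of_nonneg_edge hV hV0 hψ xc a hT ht ha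

/-! ### The profile -/

/-- A `C²` bump `B` supported in `[0, 3]` with `∫ B′² > 0` (the plateau bump of
`Blindness.exists_profile`: `B(0) = 0`, `B(1) = 1`, so `B′ = 1` somewhere by the mean value
theorem). -/
theorem exists_bump : ∃ B : ℝ → ℝ, ContDiff ℝ 2 B ∧ (∀ u, u ∉ Icc (0 : ℝ) 3 → B u = 0) ∧
    0 < ∫ u, deriv B u ^ 2 := by
  obtain ⟨B, hB, h0l, h0r, h1, -, -⟩ := exists_profile
  have h0 : ∀ u, u ∉ Icc (0 : ℝ) 3 → B u = 0 := by
    intro u hu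
    rcases lt_or_ge u 0 with h | h
    · exact h0l u h.le
    · have h3 : ¬ u ≤ 3 := fun h' => hu ⟨h, h'⟩
      exact h0r u (le_of_lt (lt_of_not_ge h3))
  refine ⟨B, hB, h0, ?_⟩
  -- `B′ = 1` somewhere in `(0, 1)`
  obtain ⟨ξ, -, hξ⟩ := exists_deriv_eq_slope B zero_lt_one hB.continuous.continuousOn
    ((hB.differentiable (by norm_num)).differentiableOn)
  have hB1 : B 1 = 1 := h1 1 ⟨le_rfl, by norm_num⟩
  have hB0 : B 0 = 0 := h0l 0 le_rfl
  rw [hB1, hB0] at hξ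
  norm_num at hξ
  have hc : Continuous fun u => deriv B u ^ 2 := (hB.continuous_deriv (by norm_num)).pow 2
  have hsupp : HasCompactSupport fun u => deriv B u ^ 2 := by
    refine hasCompactSupport_of_exterior (a := 0) (b := 3) fun u hu => ?_
    rw [deriv_eq_zero_off h0 hu]; ring
  exact hc.integral_pos_of_hasCompactSupport_nonneg_nonzero hsupp (fun u => sq_nonneg _)
    (x := ξ) (by rw [hξ]; norm_num)



/-! ### The travelling packet -/

/-- **The travelling packet** (mass `1`, tortoise centre `0`, `s = ℓ = 0`).  For every lag `h ≥ 0`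
and every `ε > 0` there is a global `C²` Regge–Wheeler solution `ψ` whose Cauchy data vanish on
the closed shell `{|x| ≤ 1}`, with `E_total(0) ≥ E₁ > 0` (`E₁ = ∫ F′²`), and a time `T ≥ 0` with
`(1 − h) + T ≥ 0` at which the LAGGED exterior energy `E[ψ; {1 − h + T < |x|}](T) ≤ ε E₁`: the
packet `F(x − t)` released deep on the horizon side has entered the lagged ball, and the true
solution differs from it by `≤ ε E₁` in energy. -/
theorem travelling_packet {r : ℝ → ℝ} (hr : IsTortoiseRadius 1 r 0) {h : ℝ} (hh : 0 ≤ h)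
    {ε : ℝ} (hε : 0 < ε) :
    ∃ ψ : ℝ → ℝ → ℝ, IsRWSolution 1 0 0 r ψ ∧ CauchyDataSupportedOn ψ {x : ℝ | 1 < |x - 0|} ∧
      (∃ a b : ℝ, a ≤ b ∧ CauchyDataSupportedOn ψ (Ioo a b)) ∧
      ∃ E₁ : ℝ, 0 < E₁ ∧ ENNReal.ofReal E₁ ≤ totalEnergy (linePotential 1 0 0 r) ψ 0 ∧
      ∃ T : ℝ, 0 ≤ T ∧ 0 ≤ (1 - h) + T ∧
        exteriorEnergy (linePotential 1 0 0 r) 0 (1 - h) ψ T ≤ ENNReal.ofReal (ε * E₁) := by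
  set V := linePotential 1 0 0 r with hVdef
  have hV1 : ContDiff ℝ 1 V := contDiff_one_linePotential hr 0 0
  have hVb := abs_linePotential_le hr (le_refl 0)
  have hVnn : ∀ x, 0 ≤ V x := fun x => linePotential_nonneg zero_le_one (le_refl 0) hr.two_mul_lt x
  have he1 : 0 < Real.exp 1 - 1 := by linarith [Real.add_one_le_exp (1 : ℝ)]
  -- the profile and its two integrals
  obtain ⟨B, hB, hB0, hI₁⟩ := exists_bump
  set I₀ : ℝ := ∫ y, B y ^ 2 with hI₀
  set I₁ : ℝ := ∫ y, deriv B y ^ 2 with hI₁def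
  have hI₀nn : 0 ≤ I₀ := integral_nonneg fun y => sq_nonneg _
  have hεI : 0 < ε * I₁ := mul_pos hε hI₁
  -- the scale `u`, the parking position `x₀ = h + 1 − 2u`
  set C : ℝ := 6 * (Real.exp 1 - 1) * Real.exp (h + 5) * I₀ / (64 * (ε * I₁)) with hC
  have hC0 : 0 ≤ C := by rw [hC]; positivity
  set u : ℝ := max (h + 3) C + 1 with hu
  have huC : C < u := by rw [hu]; linarith [le_max_right (h + 3) C]
  have huh : h + 3 < u := by rw [hu]; linarith [le_max_left (h + 3) C]
  have hu0 : 0 < u := by linarith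
  set x₀ : ℝ := h + 1 - 2 * u with hx₀
  -- the datum `F = B(· − x₀)`, supported in `[x₀, x₀ + 3]`
  set F : ℝ → ℝ := fun x => B (x - x₀) with hF
  have hFc : ContDiff ℝ 2 F := hB.comp (contDiff_id.sub contDiff_const)
  have hF0 : ∀ x, x ∉ Icc x₀ (x₀ + 3) → F x = 0 := by
    intro x hx
    apply hB0
    intro hm
    exact hx ⟨by linarith [hm.1], by linarith [hm.2]⟩
  have hF0' : ∀ x, (x < x₀ ∨ x₀ + 3 < x) → F x = 0 := by
    intro x hx
    apply hF0
    intro hm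
    rcases hx with hx | hx
    · linarith [hm.1]
    · linarith [hm.2]
  have hdF : ∀ x, deriv F x = deriv B (x - x₀) := fun x => by
    rw [hF]
    exact deriv_comp_sub_const (f := B) (a := x₀) (x := x)
  have hdF0 : ∀ x, (x < x₀ ∨ x₀ + 3 < x) → deriv F x = 0 := fun x hx => deriv_eq_zero_off hF0 hx
  have hdFc : ContDiff ℝ 1 (deriv F) := contDiff_one_deriv_of_two hFc
  have hFd : ∀ y, HasDerivAt F (deriv F y) y := fun y =>
    ((hFc.differentiable (by norm_num)) y).hasDerivAt
  -- the global solution with data `(F, −F′)`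
  obtain ⟨ψ, hψ2, hsol, hψ0, hψ1, hsupp⟩ := exists_solution (A := F) (B := fun x => -deriv F x)
    hV1 hVb hFc hF0 hdFc.neg (fun x hx => by
      have hx' : x < x₀ ∨ x₀ + 3 < x := by
        by_contra hcon
        push Not at hcon
        exact hx ⟨hcon.1, hcon.2⟩
      simp [hdF0 x hx'])
  -- the free right-mover `ψₐ(t, x) = F(x − t)`
  set ψa : ℝ → ℝ → ℝ := fun t x => F (x - t) with hψa
  have haC2 : ContDiff ℝ 2 (uncurry ψa) := hFc.comp (contDiff_snd.sub contDiff_fst)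
  have hat : ∀ t x, HasDerivAt (fun τ => ψa τ x) (-deriv F (x - t)) t := by
    intro t x
    have hlin : HasDerivAt (fun τ : ℝ => x - τ) (-1) t := by
      simpa using (hasDerivAt_id t).const_sub x
    have h1 := (hFd (x - t)).comp t hlin
    exact (h1.congr_of_eventuallyEq (Eventually.of_forall fun τ => rfl)).congr_deriv (by ring)
  have hax : ∀ t x, HasDerivAt (ψa t) (deriv F (x - t)) x := by
    intro t x
    have hlin : HasDerivAt (fun y : ℝ => y - t) 1 x := (hasDerivAt_id x).sub_const t
    have h1 := (hFd (x - t)).comp x hlin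
    exact (h1.congr_of_eventuallyEq (Eventually.of_forall fun y => rfl)).congr_deriv (by ring)
  have hares : ∀ t x, iteratedDeriv 2 (fun τ => ψa τ x) t - iteratedDeriv 2 (ψa t) x
      + V x * ψa t x = V x * F (x - t) := by
    intro t x
    have e1 : iteratedDeriv 2 (fun τ => ψa τ x) t = iteratedDeriv 2 F (x - t) := by
      show iteratedDeriv 2 (fun τ => F (x - τ)) t = _
      rw [iteratedDeriv_comp_const_sub]
      norm_num
    have e2 : iteratedDeriv 2 (ψa t) x = iteratedDeriv 2 F (x - t) := by
      show iteratedDeriv 2 (fun y => F (y - t)) x = _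
      rw [iteratedDeriv_comp_sub_const]
    rw [e1, e2]
    simp [hψa]
  have hasupp : ∀ t x, (x < x₀ - |t| ∨ x₀ + 3 + |t| < x) → ψa t x = 0 := by
    intro t x hx
    apply hF0'
    rcases hx with hx | hx
    · left; linarith [neg_le_abs t]
    · right; linarith [le_abs_self t]
  -- the error field `φ = ψ − ψₐ`: zero data, forcing `−V F(x − t)`
  set φ : ℝ → ℝ → ℝ := fun t x => ψ t x - ψa t x with hφ
  have hφ2 : ContDiff ℝ 2 (uncurry φ) := hψ2.sub haC2
  have hφsupp : ∀ t x, (x < x₀ - |t| ∨ x₀ + 3 + |t| < x) → φ t x = 0 := by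
    intro t x hx
    simp [hφ, hsupp t x hx, hasupp t x hx]
  have hφ0 : ∀ x, φ 0 x = 0 := fun x => by simp [hφ, hψa, hψ0 x]
  have hψline : ∀ x, HasDerivAt (fun τ => ψ τ x) (-deriv F x) 0 := by
    intro x
    have h1 := (hasDerivAt_time (hψ2.of_le (by norm_num)) 0 x).differentiableAt.hasDerivAt
    rwa [hψ1 x] at h1
  have hφ1 : ∀ x, deriv (fun τ => φ τ x) 0 = 0 := by
    intro x
    have h1 := (hψline x).sub (hat 0 x)
    have h' : HasDerivAt (fun τ => φ τ x) (-deriv F x - -deriv F (x - 0)) 0 :=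
      h1.congr_of_eventuallyEq (Eventually.of_forall fun τ => rfl)
    rw [h'.deriv]
    simp
  have hφres : ∀ t x, iteratedDeriv 2 (fun τ => φ τ x) t - iteratedDeriv 2 (φ t) x + V x * φ t x
      = -(V x * F (x - t)) := by
    intro t x
    obtain ⟨hψt, hψx⟩ := contDiff_two_lines hψ2 t x
    obtain ⟨hat2, hax2⟩ := contDiff_two_lines haC2 t x
    have e1 : iteratedDeriv 2 (fun τ => φ τ x) t
        = iteratedDeriv 2 (fun τ => ψ τ x) t - iteratedDeriv 2 (fun τ => ψa τ x) t :=
      iteratedDeriv_two_sub hψt hat2 t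
    have e2 : iteratedDeriv 2 (φ t) x = iteratedDeriv 2 (ψ t) x - iteratedDeriv 2 (ψa t) x :=
      iteratedDeriv_two_sub hψx hax2 x
    rw [e1, e2]
    have h1 := hsol t x
    have h2 := hares t x
    simp only [hφ]
    linear_combination h1 - h2
  -- the potential on the region swept by the packet up to time `u`: `V² ≤ η₂ = e^{h+5−u}/64`
  set η2 : ℝ := Real.exp (h + 5 - u) / 64 with hη2
  have hη2nn : 0 ≤ η2 := by rw [hη2]; positivity
  have hV2 : ∀ x, x ≤ x₀ + 3 + u → V x ^ 2 ≤ η2 := by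
    intro x hx
    have hVx : V x ≤ Real.exp ((x + 1) / 2) / 8 := linePotential_zero_zero_le hr x
    have hmono : Real.exp ((x + 1) / 2) ≤ Real.exp ((x₀ + 3 + u + 1) / 2) :=
      Real.exp_le_exp.2 (by linarith)
    have hb : V x ≤ Real.exp ((x₀ + 3 + u + 1) / 2) / 8 := by linarith
    have hsum : (x₀ + 3 + u + 1) / 2 + (x₀ + 3 + u + 1) / 2 = h + 5 - u := by rw [hx₀]; ring
    calc V x ^ 2 ≤ (Real.exp ((x₀ + 3 + u + 1) / 2) / 8) ^ 2 := pow_le_pow_left₀ (hVnn x) hb 2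
      _ = η2 := by rw [hη2, div_pow, sq, ← Real.exp_add, hsum]; norm_num
  -- the forcing is small in `L²` up to time `u`
  have hN2 : ∀ t ∈ Icc 0 u, ∫ x, (iteratedDeriv 2 (fun τ => φ τ x) t - iteratedDeriv 2 (φ t) x
      + V x * φ t x) ^ 2 ≤ η2 * I₀ := by
    intro t ht
    have heq : (fun x => (iteratedDeriv 2 (fun τ => φ τ x) t - iteratedDeriv 2 (φ t) x
        + V x * φ t x) ^ 2) = fun x => V x ^ 2 * F (x - t) ^ 2 := by
      funext x; rw [hφres t x]; ring
    rw [heq]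
    have hpt : ∀ x, V x ^ 2 * F (x - t) ^ 2 ≤ η2 * F (x - t) ^ 2 := by
      intro x
      rcases le_or_gt x (x₀ + 3 + u) with hx | hx
      · exact mul_le_mul_of_nonneg_right (hV2 x hx) (sq_nonneg _)
      · have hz : F (x - t) = 0 := hF0' _ (Or.inr (by linarith [ht.2]))
        simp [hz]
    have hcont : Continuous fun x => F (x - t) ^ 2 :=
      (hFc.continuous.comp (continuous_id.sub continuous_const)).pow 2
    have hcs : HasCompactSupport fun x => η2 * F (x - t) ^ 2 := by
      refine hasCompactSupport_of_exterior (a := x₀ + t) (b := x₀ + 3 + t) fun x hx => ?_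
      have hz : F (x - t) = 0 := by
        apply hF0'
        rcases hx with hx | hx
        · left; linarith
        · right; linarith
      simp [hz]
    have hint : Integrable fun x => η2 * F (x - t) ^ 2 :=
      (continuous_const.mul hcont).integrable_of_hasCompactSupport hcs
    have htrans : ∫ x, F (x - t) ^ 2 = I₀ := by
      have e : ∀ x, F (x - t) = B (x - (t + x₀)) := fun x => by simp only [hF]; ring_nf
      simp_rw [e]
      exact integral_sub_right_eq_self (fun y => B y ^ 2) (t + x₀)
    calc ∫ x, V x ^ 2 * F (x - t) ^ 2 ≤ ∫ x, η2 * F (x - t) ^ 2 :=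
          integral_mono_of_nonneg (Eventually.of_forall fun x => by positivity) hint
            (Eventually.of_forall hpt)
      _ = η2 * ∫ x, F (x - t) ^ 2 := integral_const_mul _ _
      _ = η2 * I₀ := by rw [htrans]
  -- the energy inequality for the error field on `[0, u]`
  have hEφ := energy_le_of_forcing hφ2 hV1 hVnn hφsupp hφ0 hφ1 hu0 (mul_nonneg hη2nn hI₀nn) hN2
  -- at time `u` the packet is inside the lagged ball: densities of `ψ` and `φ` agree outside
  have haT : 0 ≤ (1 - h) + u := by linarith
  have hagree : ∀ x ∈ {x : ℝ | (1 - h) + |u| < |x - 0|},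
      energyDensity V ψ u x = energyDensity V φ u x := by
    intro x hx
    simp only [mem_setOf_eq, sub_zero, abs_of_pos hu0] at hx
    have hxT : x - u < x₀ ∨ x₀ + 3 < x - u := by
      rcases lt_abs.1 hx with hx | hx
      · right; linarith
      · left; linarith
    have hF1 : F (x - u) = 0 := hF0' _ hxT
    have hF2 : deriv F (x - u) = 0 := hdF0 _ hxT
    have hψt := hasDerivAt_time (hψ2.of_le (by norm_num)) u x
    have hψx := hasDerivAt_space (hψ2.of_le (by norm_num)) u x
    have hφt : HasDerivAt (fun τ => φ τ x)
        (fderiv ℝ (uncurry ψ) (u, x) (1, 0) - -deriv F (x - u)) u :=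
      (hψt.sub (hat u x)).congr_of_eventuallyEq (Eventually.of_forall fun τ => rfl)
    have hφx : HasDerivAt (φ u) (fderiv ℝ (uncurry ψ) (u, x) (0, 1) - deriv F (x - u)) x :=
      (hψx.sub (hax u x)).congr_of_eventuallyEq (Eventually.of_forall fun y => rfl)
    unfold energyDensity
    rw [hψt.deriv, hψx.deriv, hφt.deriv, hφx.deriv, hF2]
    simp [hφ, hψa, hF1]
  have hmeas : MeasurableSet {x : ℝ | (1 - h) + |u| < |x - 0|} :=
    (isOpen_lt continuous_const (continuous_abs.comp (continuous_id.sub continuous_const))).measurableSet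
  have hext : exteriorEnergy V 0 (1 - h) ψ u
      ≤ ENNReal.ofReal ((Real.exp 1 - 1) * u ^ 2 * (η2 * I₀)) := by
    unfold exteriorEnergy
    calc ∫⁻ x in {x : ℝ | (1 - h) + |u| < |x - 0|}, ENNReal.ofReal (energyDensity V ψ u x)
        = ∫⁻ x in {x : ℝ | (1 - h) + |u| < |x - 0|}, ENNReal.ofReal (energyDensity V φ u x) :=
          setLIntegral_congr_fun hmeas (fun x hx => by rw [hagree x hx])
      _ ≤ ∫⁻ x, ENNReal.ofReal (energyDensity V φ u x) := setLIntegral_le_lintegral _ _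
      _ = ENNReal.ofReal (∫ x, energyDensity V φ u x) := by
          unfold energyDensity
          rw [ofReal_integral_eq_lintegral_ofReal
            (integrable_energyDensity hV1.continuous hφ2 hφsupp u)
            (Eventually.of_forall fun x => ReggeWheeler.energyDensity_nonneg φ u (hVnn x))]
      _ ≤ ENNReal.ofReal ((Real.exp 1 - 1) * u ^ 2 * (η2 * I₀)) :=
          ENNReal.ofReal_le_ofReal (hEφ u ⟨hu0.le, le_rfl⟩)
  -- the initial energy: `E_total(0) ≥ ∫ F′² = ∫ B′² = I₁`
  have hE : ENNReal.ofReal I₁ ≤ totalEnergy V ψ 0 := by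
    unfold totalEnergy
    have hI₁F : I₁ = ∫ x, deriv F x ^ 2 := by
      simp_rw [hdF]
      exact (integral_sub_right_eq_self (fun y => deriv B y ^ 2) x₀).symm
    have hcs : HasCompactSupport fun x => deriv F x ^ 2 :=
      hasCompactSupport_of_exterior (a := x₀) (b := x₀ + 3) fun x hx => by rw [hdF0 x hx]; ring
    have hintF : Integrable fun x => deriv F x ^ 2 :=
      (hdFc.continuous.pow 2).integrable_of_hasCompactSupport hcs
    rw [hI₁F, ofReal_integral_eq_lintegral_ofReal hintF (Eventually.of_forall fun x => sq_nonneg _)]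
    refine lintegral_mono fun x => ENNReal.ofReal_le_ofReal ?_
    have hψ0' : ψ 0 = F := funext hψ0
    unfold energyDensity
    rw [hψ0']
    nlinarith [sq_nonneg (deriv (fun τ => ψ τ x) 0), mul_nonneg (hVnn x) (sq_nonneg (F x))]
  -- the smallness of the bound: `(e − 1) u² e^{h+5−u} I₀ / 64 ≤ ε I₁`
  have hsmall : (Real.exp 1 - 1) * u ^ 2 * (η2 * I₀) ≤ ε * I₁ := by
    have hexp : u ^ 3 ≤ 6 * Real.exp u := by
      have h3 := Real.pow_div_factorial_le_exp u hu0.le 3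
      have hfac : ((Nat.factorial 3 : ℕ) : ℝ) = 6 := by norm_num [Nat.factorial]
      rw [hfac, div_le_iff₀ (by norm_num : (0 : ℝ) < 6)] at h3
      linarith
    have hprod : Real.exp u * Real.exp (-u) = 1 := by rw [← Real.exp_add]; simp
    have hsplit : Real.exp (h + 5 - u) = Real.exp (h + 5) * Real.exp (-u) := by
      rw [← Real.exp_add]; ring_nf
    have hue : u ^ 2 * Real.exp (-u) ≤ 6 / u := by
      rw [le_div_iff₀ hu0]
      have e3 : u ^ 2 * Real.exp (-u) * u = u ^ 3 * Real.exp (-u) := by ring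
      rw [e3]
      calc u ^ 3 * Real.exp (-u) ≤ 6 * Real.exp u * Real.exp (-u) :=
            mul_le_mul_of_nonneg_right hexp (Real.exp_pos _).le
        _ = 6 := by rw [mul_assoc, hprod, mul_one]
    have hK : 0 ≤ (Real.exp 1 - 1) * Real.exp (h + 5) * I₀ / 64 := by positivity
    calc (Real.exp 1 - 1) * u ^ 2 * (η2 * I₀)
        = (Real.exp 1 - 1) * Real.exp (h + 5) * I₀ / 64 * (u ^ 2 * Real.exp (-u)) := by
          rw [hη2, hsplit]; ring
      _ ≤ (Real.exp 1 - 1) * Real.exp (h + 5) * I₀ / 64 * (6 / u) :=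
          mul_le_mul_of_nonneg_left hue hK
      _ = C * (ε * I₁) / u := by
          rw [hC]
          field_simp
      _ ≤ ε * I₁ := by
          rw [div_le_iff₀ hu0]
          nlinarith [huC, hεI]
  -- the Cauchy data vanish off `(x₀ − 1, x₀ + 4)`, in particular on the closed shell `{|x| ≤ 1}`
  have hvan : ∀ x, (x < x₀ ∨ x₀ + 3 < x) → ψ 0 x = 0 ∧ deriv (fun τ => ψ τ x) 0 = 0 := by
    intro x hx'
    refine ⟨by rw [hψ0 x]; exact hF0' x hx', ?_⟩
    rw [hψ1 x, hdF0 x hx']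
    simp
  have hdataI : CauchyDataSupportedOn ψ (Ioo (x₀ - 1) (x₀ + 4)) := by
    intro x hx
    apply hvan
    simp only [mem_Ioo, not_and_or, not_lt] at hx
    rcases hx with hx | hx
    · left; linarith
    · right; linarith
  -- assemble
  refine ⟨ψ, ⟨hψ2, fun z => hsol z.1 z.2⟩, ?_, ⟨x₀ - 1, x₀ + 4, by linarith, hdataI⟩, I₁, hI₁, hE,
    u, hu0.le, haT, hext.trans (ENNReal.ofReal_le_ofReal hsmall)⟩
  intro x hx
  simp only [mem_setOf_eq, sub_zero, not_lt] at hx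
  exact hvan x (Or.inr (by linarith [neg_abs_le x, abs_nonneg x]))



/-! ### One-ended channels fail -/

/-- **The forward channel alone fails**: for every `h ≥ 0` and `c > 0` there are (mass `1`,
`xc = 0`, `s = ℓ = 0`) a tortoise radius function and a global `C²` Regge–Wheeler solution with
data vanishing on the closed shell `{|x| ≤ 1}` for which `c · E_total(0) ≤ E⁺(1 − h)` is false. -/
theorem forward_channel_fails {h : ℝ} (hh : 0 ≤ h) {c : ℝ} (hc : 0 < c) :
    ∃ (r : ℝ → ℝ) (ψ : ℝ → ℝ → ℝ), IsTortoiseRadius 1 r 0 ∧ IsRWSolution 1 0 0 r ψ ∧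
      CauchyDataSupportedOn ψ {x : ℝ | 1 < |x - 0|} ∧
      ¬ (ENNReal.ofReal c * totalEnergy (linePotential 1 0 0 r) ψ 0 ≤
          channelEnergy (linePotential 1 0 0 r) 0 (1 - h) ψ atTop) := by
  set r : ℝ → ℝ := tortoiseRadius one_pos 0 with hr_def
  have hr : IsTortoiseRadius 1 r 0 := isTortoiseRadius_tortoiseRadius one_pos 0
  have hε : 0 < c / 2 := by positivity
  obtain ⟨ψ, hψ, hdata, -, E₁, hE₁, hE, T, hT0, haT, hext⟩ := travelling_packet hr hh hε
  refine ⟨r, ψ, hr, hψ, hdata, fun hCI => ?_⟩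
  have hVd : Differentiable ℝ (linePotential 1 0 0 r) := RW.differentiable_linePotential hr 0 0
  have hVnn : ∀ x, 0 ≤ linePotential 1 0 0 r x := fun x =>
    linePotential_nonneg zero_le_one (le_refl 0) hr.two_mul_lt x
  have hchan := channelEnergy_atTop_le_exteriorEnergy hVd hVnn hψ 0 (1 - h) hT0 haT
  have key : ENNReal.ofReal (c * E₁) ≤ ENNReal.ofReal (c / 2 * E₁) := by
    calc ENNReal.ofReal (c * E₁) = ENNReal.ofReal c * ENNReal.ofReal E₁ := ENNReal.ofReal_mul hc.le
      _ ≤ ENNReal.ofReal c * totalEnergy (linePotential 1 0 0 r) ψ 0 := by gcongr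
      _ ≤ _ := hCI
      _ ≤ _ := hchan
      _ ≤ ENNReal.ofReal (c / 2 * E₁) := hext
  have key' := (ENNReal.ofReal_le_ofReal_iff (by positivity)).1 key
  nlinarith

/-- **The backward channel alone fails** (time reversal of `forward_channel_fails`): for every
`h ≥ 0` and `c > 0` there is a global `C²` Regge–Wheeler solution (mass `1`, `xc = 0`,
`s = ℓ = 0`) with data vanishing on `{|x| ≤ 1}` for which `c · E_total(0) ≤ E⁻(1 − h)` fails. -/
theorem backward_channel_fails {h : ℝ} (hh : 0 ≤ h) {c : ℝ} (hc : 0 < c) :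
    ∃ (r : ℝ → ℝ) (ψ : ℝ → ℝ → ℝ), IsTortoiseRadius 1 r 0 ∧ IsRWSolution 1 0 0 r ψ ∧
      CauchyDataSupportedOn ψ {x : ℝ | 1 < |x - 0|} ∧
      ¬ (ENNReal.ofReal c * totalEnergy (linePotential 1 0 0 r) ψ 0 ≤
          channelEnergy (linePotential 1 0 0 r) 0 (1 - h) ψ atBot) := by
  set r : ℝ → ℝ := tortoiseRadius one_pos 0 with hr_def
  have hr : IsTortoiseRadius 1 r 0 := isTortoiseRadius_tortoiseRadius one_pos 0
  have hε : 0 < c / 2 := by positivity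
  obtain ⟨ψ, hψ, hdata, -, E₁, hE₁, hE, T, hT0, haT, hext⟩ := travelling_packet hr hh hε
  set V := linePotential 1 0 0 r with hV
  have hVd : Differentiable ℝ V := RW.differentiable_linePotential hr 0 0
  have hVnn : ∀ x, 0 ≤ V x := fun x => linePotential_nonneg zero_le_one (le_refl 0) hr.two_mul_lt x
  -- the time-reversed solution `χ(t, x) = ψ(−t, x)`
  set χ : ℝ → ℝ → ℝ := fun t x => ψ (-t) x with hχ
  have hχ2 : ContDiff ℝ 2 (uncurry χ) :=
    hψ.1.comp ((contDiff_neg.comp contDiff_fst).prodMk contDiff_snd)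
  have hχsol : IsRWSolution 1 0 0 r χ := by
    refine ⟨hχ2, fun z => ?_⟩
    have h1 : iteratedDeriv 2 (fun τ => χ τ z.2) z.1 = iteratedDeriv 2 (fun τ => ψ τ z.2) (-z.1) := by
      show iteratedDeriv 2 (fun τ => ψ (-τ) z.2) z.1 = _
      rw [iteratedDeriv_comp_neg 2 (fun τ => ψ τ z.2) z.1]
      norm_num
    show iteratedDeriv 2 (fun τ => χ τ z.2) z.1 - iteratedDeriv 2 (ψ (-z.1)) z.2
      + V z.2 * ψ (-z.1) z.2 = 0
    rw [h1]
    exact hψ.2 (-z.1, z.2)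
  have hdens : ∀ t x, energyDensity V χ t x = energyDensity V ψ (-t) x := by
    intro t x
    show deriv (fun τ => ψ (-τ) x) t ^ 2 + deriv (ψ (-t)) x ^ 2 + V x * ψ (-t) x ^ 2
      = deriv (fun τ => ψ τ x) (-t) ^ 2 + deriv (ψ (-t)) x ^ 2 + V x * ψ (-t) x ^ 2
    rw [deriv_comp_neg (fun τ => ψ τ x) t]
    ring
  have hext' : ∀ s, exteriorEnergy V 0 (1 - h) χ s = exteriorEnergy V 0 (1 - h) ψ (-s) := by
    intro s
    unfold exteriorEnergy
    simp_rw [hdens, abs_neg]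
  have htot : totalEnergy V χ 0 = totalEnergy V ψ 0 := by
    unfold totalEnergy
    simp_rw [hdens, neg_zero]
  have hdataχ : CauchyDataSupportedOn χ {x : ℝ | 1 < |x - 0|} := by
    intro x hx
    obtain ⟨h0, h1⟩ := hdata x hx
    refine ⟨by simpa [hχ] using h0, ?_⟩
    show deriv (fun τ => ψ (-τ) x) 0 = 0
    rw [deriv_comp_neg (fun τ => ψ τ x) 0, neg_zero, h1, neg_zero]
  refine ⟨r, χ, hr, hχsol, hdataχ, fun hCI => ?_⟩
  have hchan : channelEnergy V 0 (1 - h) χ atBot ≤ ENNReal.ofReal (c / 2 * E₁) := by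
    unfold channelEnergy
    refine liminf_le_of_frequently_le' (Eventually.frequently ?_)
    filter_upwards [eventually_le_atBot (-T)] with s hs
    rw [hext' s]
    have hs' : T ≤ -s := by linarith
    exact (exteriorEnergy_antitone_of_nonneg_edge hVd hVnn hψ 0 (1 - h) hT0 hs' haT).trans hext
  have key : ENNReal.ofReal (c * E₁) ≤ ENNReal.ofReal (c / 2 * E₁) := by
    calc ENNReal.ofReal (c * E₁) = ENNReal.ofReal c * ENNReal.ofReal E₁ := ENNReal.ofReal_mul hc.le
      _ ≤ ENNReal.ofReal c * totalEnergy V ψ 0 := by gcongr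
      _ = ENNReal.ofReal c * totalEnergy V χ 0 := by rw [htot]
      _ ≤ _ := hCI
      _ ≤ ENNReal.ofReal (c / 2 * E₁) := hchan
  have key' := (ENNReal.ofReal_le_ofReal_iff (by positivity)).1 key
  nlinarith


/-! ### Tightness: the constant never exceeds one -/

/-- **Tightness of the constant.** If a lag `h ≥ 0` and a constant `c` satisfy the inner statement
of `WindowedShellChannels` at `M = ρ = 1` (for all tortoise radius functions, spins, angular
numbers and shell-supported solutions), then `c ≤ 1`: the travelling packet of
`TravellingPacket.lean` has `E⁺(1 − h) ≤ ε E_total` while always `E⁻ ≤ E_total`, so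
`lost⁺ + lost⁻ ≥ (1 − ε) E_total` is attained — at best ONE of the two time directions catches the
energy; no `c(M, ρ) > 1` can ever be proved. -/
theorem windowedShellChannels_const_le_one {h c : ℝ} (hh : 0 ≤ h)
    (H : ∀ (r : ℝ → ℝ) (xc : ℝ), IsTortoiseRadius 1 r xc → ∀ (s ℓ : ℕ), s ≤ 2 → s ≤ ℓ →
      ∀ ψ : ℝ → ℝ → ℝ, IsRWSolution 1 s ℓ r ψ → CauchyDataSupportedOn ψ {x : ℝ | 1 < |x - xc|} →
      ENNReal.ofReal c * totalEnergy (linePotential 1 s ℓ r) ψ 0 ≤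
        channelEnergy (linePotential 1 s ℓ r) xc (1 - h) ψ atTop +
          channelEnergy (linePotential 1 s ℓ r) xc (1 - h) ψ atBot) : c ≤ 1 := by
  by_contra hc1
  push Not at hc1
  set r : ℝ → ℝ := tortoiseRadius one_pos 0 with hr_def
  have hr : IsTortoiseRadius 1 r 0 := isTortoiseRadius_tortoiseRadius one_pos 0
  have hε : 0 < (c - 1) / 2 := by linarith
  obtain ⟨ψ, hψ, hdata, ⟨a, b, hab, hdataI⟩, E₁, hE₁, hE, T, hT0, haT, hext⟩ :=
    travelling_packet hr hh hε
  set V := linePotential 1 0 0 r with hV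
  have hVd : Differentiable ℝ V := RW.differentiable_linePotential hr 0 0
  have hVnn : ∀ x, 0 ≤ V x := fun x => linePotential_nonneg zero_le_one (le_refl 0) hr.two_mul_lt x
  -- the total energy is finite and conserved
  have hcons : ∀ t, totalEnergy V ψ t = totalEnergy V ψ 0 := fun t => by
    rw [hV, RW.totalEnergy_eq_rw hr (le_refl 0) hψ hab hdataI t,
      RW.totalEnergy_eq_rw hr (le_refl 0) hψ hab hdataI 0]
  set E := totalEnergy V ψ 0 with hEdef
  have hEfin : E ≠ ⊤ := by
    rw [hEdef, hV, RW.totalEnergy_eq_rw hr (le_refl 0) hψ hab hdataI 0]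
    exact ENNReal.ofReal_ne_top
  -- forward: the travelling packet; backward: never more than the total energy
  have hplus : channelEnergy V 0 (1 - h) ψ atTop ≤ ENNReal.ofReal ((c - 1) / 2 * E₁) :=
    (channelEnergy_atTop_le_exteriorEnergy hVd hVnn hψ 0 (1 - h) hT0 haT).trans hext
  have hminus : channelEnergy V 0 (1 - h) ψ atBot ≤ E := by
    unfold channelEnergy
    refine liminf_le_of_frequently_le' (Eventually.frequently (Eventually.of_forall fun t => ?_))
    exact (exteriorEnergy_le_totalEnergy V 0 (1 - h) ψ t).trans_eq ((hcons t).trans hEdef)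
  have key : ENNReal.ofReal c * E ≤ ENNReal.ofReal ((c - 1) / 2 * E₁) + E :=
    (H r 0 hr 0 0 (Nat.zero_le _) le_rfl ψ hψ hdata).trans (add_le_add hplus hminus)
  -- in real numbers
  set e : ℝ := E.toReal with he
  have hEe : E = ENNReal.ofReal e := (ENNReal.ofReal_toReal hEfin).symm
  have he0 : 0 ≤ e := ENNReal.toReal_nonneg
  have he1 : E₁ ≤ e := by
    have h1 := hE
    rw [hEe] at h1
    exact (ENNReal.ofReal_le_ofReal_iff he0).1 h1
  rw [hEe] at key
  have key2 : ENNReal.ofReal (c * e) ≤ ENNReal.ofReal ((c - 1) / 2 * E₁ + e) := by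
    calc ENNReal.ofReal (c * e) = ENNReal.ofReal c * ENNReal.ofReal e :=
          ENNReal.ofReal_mul (by linarith)
      _ ≤ ENNReal.ofReal ((c - 1) / 2 * E₁) + ENNReal.ofReal e := key
      _ = ENNReal.ofReal ((c - 1) / 2 * E₁ + e) := (ENNReal.ofReal_add (by positivity) he0).symm
  have key3 := (ENNReal.ofReal_le_ofReal_iff (by positivity)).1 key2
  nlinarith [mul_pos (show 0 < c - 1 by linarith) hE₁]

/-! ### The one-ended specialisations of the crux are false -/

/-- **`WindowedShellChannels` with the backward channel deleted is false**: there are no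
`h = h(M, ρ) ≥ 0`, `c = c(M, ρ) > 0` with `c · E_total(0) ≤ liminf_{t → +∞} E[ψ; {ρ − h + |t| <
|x − xc|}]` for all shell-supported Regge–Wheeler data — already at `M = ρ = 1`, `s = ℓ = 0`, by
`forward_channel_fails` (a packet travelling towards the shell from deep on the horizon side enters
the lagged ball and stays there).  The proposition negated is the crux with the summand
`+ channelEnergy … atBot` deleted (everything else verbatim). -/
theorem windowedShellChannels_false_without_backwardChannel :
    ¬ (∀ M : ℝ, 0 < M → ∀ ρ : ℝ, 0 < ρ → ∃ h : ℝ, 0 ≤ h ∧ ∃ c : ℝ, 0 < c ∧ ∀ (r : ℝ → ℝ) (xc : ℝ),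
        IsTortoiseRadius M r xc → ∀ (s ℓ : ℕ), s ≤ 2 → s ≤ ℓ → ∀ ψ : ℝ → ℝ → ℝ,
        IsRWSolution M s ℓ r ψ → CauchyDataSupportedOn ψ {x : ℝ | ρ < |x - xc|} →
        ENNReal.ofReal c * totalEnergy (linePotential M s ℓ r) ψ 0 ≤
          channelEnergy (linePotential M s ℓ r) xc (ρ - h) ψ atTop) := by
  intro hK
  obtain ⟨h, hh, c, hc, H⟩ := hK 1 one_pos 1 one_pos
  obtain ⟨r, ψ, hr, hψ, hdata, hfail⟩ := forward_channel_fails hh hc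
  exact hfail (H r 0 hr 0 0 (Nat.zero_le _) le_rfl ψ hψ hdata)

/-- **`WindowedShellChannels` with the forward channel deleted is false** (time reversal):
no `h ≥ 0`, `c > 0` give `c · E_total(0) ≤ liminf_{t → −∞} E[ψ; {ρ − h + |t| < |x − xc|}]` for
all shell-supported data, by `backward_channel_fails`.  The proposition negated is the crux with
the summand `channelEnergy … atTop +` deleted (everything else verbatim). -/
theorem windowedShellChannels_false_without_forwardChannel :
    ¬ (∀ M : ℝ, 0 < M → ∀ ρ : ℝ, 0 < ρ → ∃ h : ℝ, 0 ≤ h ∧ ∃ c : ℝ, 0 < c ∧ ∀ (r : ℝ → ℝ) (xc : ℝ),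
        IsTortoiseRadius M r xc → ∀ (s ℓ : ℕ), s ≤ 2 → s ≤ ℓ → ∀ ψ : ℝ → ℝ → ℝ,
        IsRWSolution M s ℓ r ψ → CauchyDataSupportedOn ψ {x : ℝ | ρ < |x - xc|} →
        ENNReal.ofReal c * totalEnergy (linePotential M s ℓ r) ψ 0 ≤
          channelEnergy (linePotential M s ℓ r) xc (ρ - h) ψ atBot) := by
  intro hK
  obtain ⟨h, hh, c, hc, H⟩ := hK 1 one_pos 1 one_pos
  obtain ⟨r, ψ, hr, hψ, hdata, hfail⟩ := backward_channel_fails hh hc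
  exact hfail (H r 0 hr 0 0 (Nat.zero_le _) le_rfl ψ hψ hdata)


/-- (a) **Any proof must use the backward channel.** -/
theorem windowedShellChannels_false_without_backwardChannel' :
    ¬ WindowedShellChannelsWithoutBackwardChannel :=
  windowedShellChannels_false_without_backwardChannel

/-- (a) **Any proof must use the forward channel.** -/
theorem windowedShellChannels_false_without_forwardChannel' :
    ¬ WindowedShellChannelsWithoutForwardChannel :=
  windowedShellChannels_false_without_forwardChannel

/-- (b) **Tightness read against the crux**: if `WindowedShellChannels` holds, the `(h, c)` it
provides at `M = ρ = 1` has `c ≤ 1`. -/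
theorem windowedShellChannels_const_le_one_of (hW : WindowedShellChannels) :
    ∃ h : ℝ, 0 ≤ h ∧ ∃ c : ℝ, 0 < c ∧ c ≤ 1 ∧ ∀ (r : ℝ → ℝ) (xc : ℝ),
      IsTortoiseRadius 1 r xc → ∀ (s ℓ : ℕ), s ≤ 2 → s ≤ ℓ → ∀ ψ : ℝ → ℝ → ℝ,
      IsRWSolution 1 s ℓ r ψ → CauchyDataSupportedOn ψ {x : ℝ | 1 < |x - xc|} →
      ENNReal.ofReal c * totalEnergy (linePotential 1 s ℓ r) ψ 0 ≤
        channelEnergy (linePotential 1 s ℓ r) xc (1 - h) ψ atTop +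
          channelEnergy (linePotential 1 s ℓ r) xc (1 - h) ψ atBot := by
  obtain ⟨h, hh, c, hc, H⟩ := hW 1 one_pos 1 one_pos
  exact ⟨h, hh, c, hc, windowedShellChannels_const_le_one hh H, H⟩

/-! ## Near-misses (conjectural NEGATIVE facts — NOT proved; obstruction in the docstrings) -/

/-- NEAR-MISS (believed true = the deletion is FALSE; not provable here).  Without the support
hypothesis, data concentrated at the photon sphere (`ℓ → ∞` packets at the barrier top `x ≈ xc`,
frequency `ω² = V_max(1 + O(ℓ^{-1}))`) leak out symmetrically in time on the Ehrenfest scale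
`≍ λ⁻¹ ln ℓ = 3√3 M ln ℓ → ∞`, so for every fixed `h` both lagged channel energies are `o(E)`.
Obstruction: needs semiclassical transport (Gaussian beams / inverted-oscillator normal form) with
energy-norm error control for times `~ M ln ℓ`; the tree only has frozen packets (times `3/m³ → 0`)
and the Duhamel bound `(e−1)T²N²`, which is useless once `T ≳ 1/‖V − V_model‖`.  This is the `1+1`
quantitative form of `Literature.Barriers.FinalStateConjecture.SbierskiTrappingObstruction`; the
crux evades it precisely through the support hypothesis. -/
theorem windowedShellChannels_false_without_support : ¬ WindowedShellChannelsWithoutSupport := by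
  sorry

/-- NEAR-MISS (believed true; not provable here).  No `(h, c)` uniform in `ρ`: rays released at
rest at area radius `r₀ ↓ 3M` (just outside a shell of half-width `ρ → 0`) escape hyperbolically
with SYMMETRIC retarded/advanced lag `Λ(r₀) − r_*(r₀) → +∞` (logarithmic, Lyapunov exponent
`1/(3√3 M)`; planner table `u_∞/M = 20.1, 6.28, 2.64` at `r₀/M = 3.05, 4, 6`), so for fixed `h`
and `ρ` small enough a high-`ℓ` rest packet at the shell edge is lost in both directions.
Obstruction: same as above (long-time transport near the barrier top). -/
theorem not_windowedShellChannels_uniform_in_rho : ¬ WindowedShellChannelsUniformInRho := by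
  sorry

/-- NEAR-MISS (believed true; not provable here): **the lag is at least `4M ln 2`**.  If `(h, c)`
satisfy the inner statement of the crux at `(M, ρ)` then `h ≥ 4M log 2` (indeed
`h ≥ Λ_near(ρ) > 4M log 2`, `Λ_near(ρ)/M = 11.5, 8.33, 5.61, 4.37, 3.71, 3.11, 2.89, 2.82` at
`ρ/M = .5, 1, 2, 3, 4, 6, 8, 10`, planner numerics, `↓ 4 log 2 = 2.77`): a horizon-side rest packet at
Kruskal position `X₁ < X_e = κ⁻¹e^{κ(xc−ρ)}` crosses `𝓗⁺` at `V = 2X₁` and `𝓗⁻` at `|U| = 2X₁`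
(midpoint law of the Rindler/Klein–Gordon dictionary, exact for the exponential model
`V = m²e^{2κx}`, `κ = 1/4M`), i.e. with SYMMETRIC lag `κ⁻¹ ln 2` behind the light rays from its
own position; a packet flush below the edge `xc − ρ` is caught (in either direction) iff its lag is
`< h`, so both lagged channel energies of it are `o(E)` when `h < 4M ln 2`.
ROUTE TO A PROOF (charted, not executed; for a later cycle): the DICTIONARY "lag `h` for data flush
below the shell edge `−ρ`" = "SHARP cone from the edge `−ρ' := −ρ + h` for a packet at depth `h`
below it" turns this into the horizon-side estimate of the K1 programme, whose pieces are LANDED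
under `Theorems/UniformPhotonSphereChannels/Negative/`: `WaveDefect.rindler_solution` (conformal
composite `u(T,X)` solves `u_TT − u_XX + Wu = 0`, `W = e^{−2κx}V`), `RWNear.w_le/w_ge/
abs_deriv_w_le` + `WaveDefect.chart_bounds` (mass `≍ ℓ/M`, variation `O(X_e/M²)`),
`WaveDefect.rw_energy_slice_le` (RW energy of the slice `t = t₁` ≤ `2κX₂ ×` flux through the ray
`T = βX`), `WaveDefect.ray_flux_le` (flux through the ray ≤ energy at Minkowski time `T_lo` left
of `X₂ = X_* + T_hi − T_lo` + slow-variation error), `WaveDefect.pinning_bound` (energy leaked to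
the left of the initial `X`-support by time `T₁` is small: the packet is PINNED in the Minkowski
frame), `WaveDefect.geometry/initial_energy_le/exists_data/exists_solution` (fixed geometry:
packet on `[−ρ'−4M/5, −ρ'−2M/5]`, ray `β = 1/2`, `t₁ = 2M log 3`, `X_* = 2X_e/3`).  The missing
file is the announced but never landed `HorizonEstimate` (assembly of ray flux + pinning + slice
energy); with the fixed geometry it yields: for `ρ ≥ ρ₁(M)` (so that `X_e ≤ M/3`) and EVERY
`h ≤ 2M/5`, `c > 0`, the inner statement of the crux fails (`ℓ → ∞` even rest packets) — i.e.
`h(M, ρ) > 2M/5` for all large `ρ`; re-parametrising `geometry` (`β ↑ 1`, `X_* ↓ X_e/2`) pushes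
`2/5` towards `4 log 2`.  Small `ρ` (edge near the photon sphere, `X_e ≍ M`) has no small
parameter for this method.  Obstruction to the full statement: needs either exact
Rindler–Klein–Gordon solutions (Macdonald functions, not in Mathlib) with a Duhamel comparison over
times `≍ M`, or semiclassical transport; frozen packets give only `h > 0` (`FalseWithoutLag`). -/
theorem lag_ge_four_mul_log_two {M ρ h c : ℝ} (hM : 0 < M) (hρ : 0 < ρ) (hh : 0 ≤ h) (hc : 0 < c)
    (H : ∀ (r : ℝ → ℝ) (xc : ℝ), IsTortoiseRadius M r xc → ∀ (s ℓ : ℕ), s ≤ 2 → s ≤ ℓ →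
      ∀ ψ : ℝ → ℝ → ℝ, IsRWSolution M s ℓ r ψ → CauchyDataSupportedOn ψ {x : ℝ | ρ < |x - xc|} →
      ENNReal.ofReal c * totalEnergy (linePotential M s ℓ r) ψ 0 ≤
        channelEnergy (linePotential M s ℓ r) xc (ρ - h) ψ atTop +
          channelEnergy (linePotential M s ℓ r) xc (ρ - h) ψ atBot) :
    4 * M * Real.log 2 ≤ h := by
  sorry

end Summit.FinalStateConjecture.FinalStateConjecture.Cruxes.WindowedShellChannels.Disproof

end
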